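import Literature.Geometry.Kaehler.ComplexTorusNonSimpleAbelianThreefoldTimesEllipticCurve
import HarnessLib

/-!
# The Hodge group of `(Y × E') × E` for a simple abelian surface `Y` (Moonen–Zarhin Prop. (3.8): it splits iff
# `E' ≁ E`), and «`Hg(X) = Sp_D(V,φ)`» for the fourfolds `T × E` of Thm. (0.1) (4) outside case (a)

Layer `Literature/Geometry/Kaehler`, namespace `Literature.Geometry.Kaehler.ComplexTorus`; lane `lit-hodgefound`
(Track 2 foundations library), Layer A4 (known cases of `D = B`), prover seat `lit-hodgefound-p17` (generation 51),
self-proposed row g51-#8 — sequel of g51-#6 (`ComplexTorusNonSimpleAbelianThreefoldTimesEllipticCurve`: for a simple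
abelian surface `Y` and a CM curve `E_τ`, `Hg((Y × E_{τ'}) × E_τ)(ℂ)` splits unless `E_{τ'} ∼ E_τ`; `T × E_τ` satisfies
(D)).  Here: (i) the full dichotomy of Prop. (3.8) for `X = Y × E_{τ'}`: `Hg(X × E_τ) = Hg(X) × Hg(E_τ)` if and ONLY
if `E_{τ'}` and `E_τ` are not isogenous (for `E_τ` without complex multiplication through Lemma (3.4):
`Hom(E_τ, Y × E_{τ'}) = Hom(E_τ, Y) ⊕ Hom(E_τ, E_{τ'}) = Hom(E_τ, E_{τ'})`; «We may have that `Hg(X₁ × X₂) ≠ Hg(X₁) ×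
Hg(X₂)`, e.g. if `Hom(X₁, X₂) ≠ 0`»); (ii) the other half of Thm. (0.1) (4), «`Hg(X) = Sp_D(V,φ)`», for the fourfolds
`T × E_τ` outside case (a) and `(Y × E_{τ'}) × E_τ`, from their condition (D) (g51-#5, g51-#6) by the tree's
Murty–Gordon–Milne theorem «stably nondegenerate ⟹ `Hg = Lf = S`».  THEOREMS ONLY (no definition, no instance, no
notation, no named fact; D-0026, net debt 0).

## Sources, VERBATIM (held `paper:arxiv-math_9901113`)

* B. J. J. Moonen, Yu. G. Zarhin [MoonenZarhin1999LowDim], *Hodge classes on abelian varieties of low dimension*, Math.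
  Ann. **315** (1999).  §3 (3.1) (p0006 L53–L60): «We may have that `Hg(X₁ × X₂) ≠ Hg(X₁) × Hg(X₂)`, e.g. if
  `Hom(X₁, X₂) ≠ 0`.»; Lemma (3.4) (p0006 L133; arXiv v2 = Math. Ann. numbering — earlier tree copies of this family wrote «Lemma (3.5)», which is Borovoi’s Remark) and Prop. (3.8) (p0007 L55–L74): «Suppose `Hom(E,X) = 0`. Then either
  `Hg(X × E) = Hg(X) × Hg(E)` or `End⁰(E) = k` is an imaginary quadratic field such that there exists an embedding of `k`
  into the center of `End⁰(X)`. If `End⁰(E) = ℚ` then we apply Lemma (3.4).»; Thm. (0.1) (4) (p0001 L131–L135):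
  «Suppose we are not in one of the cases (a), (b), (c) or (d). Then `Hg(X) = Sp_D(V,φ)` and `ℬ•(Xⁿ) = 𝒟•(Xⁿ)` for all
  `n`.»; §5 (5.4)–(5.5) (p0009 L82–L97).
* B. B. Gordon [Gordon1997], *A survey of the Hodge conjecture for abelian varieties*, Thm. 7.5 («the following are
  equivalent: (1) `A` is stably nondegenerate … (2) `Hg(A) = Lf(A)`»), Def. 2.14 (`Lf(A)`), 7.6.1–7.6.2.
* J. S. Milne [Milne1999LefschetzClasses], *Lefschetz classes on abelian varieties*, §4 Thm. 4.4, Cor. 4.5, Prop. 4.8.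
* V. K. Murty [Murty1984], *Exceptional Hodge classes on certain abelian varieties*, Main Theorem.
* H. Lange [Lange2023AbelianVarietiesComplex], *Abelian Varieties over the Complex Numbers* (2023), §2.4.4 Cor. 2.4.26
  (`Hom` of products), §1.1.2 Cor. 1.1.16.

## Contents

* §1 `homRat_prod_right_eq_bot_iff` (`Hom_ℚ(Z, X₁ × X₂) = 0 ⟺ Hom_ℚ(Z, X₁) = 0 ∧ Hom_ℚ(Z, X₂) = 0`),
  **`IsSimple.homRat_ellipticPeriod_prod_ellipticPeriod_eq_bot_iff`** (`Y` a simple surface: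
  `Hom_ℚ(E_τ, Y × E_{τ'}) = 0 ⟺ E_τ ≁ E_{τ'}`).
* §2 **`IsSimple.hodgeGroupC_prod_ellipticPeriod_prod_ellipticPeriod_eq_blockDiagProd_iff`**: for a simple polarised
  abelian surface `Y` and ALL `τ', τ`: `Hg((Y × E_{τ'}) × E_τ)(ℂ) = Hg(Y × E_{τ'})(ℂ) × Hg(E_τ)(ℂ) ⟺ E_{τ'} ≁ E_τ`;
  real points `IsSimple.hodgeGroup_prod_ellipticPeriod_prod_ellipticPeriod_eq_iff`.
* §3 «`Hg(X) = Sp_D(V,φ)`» (real points `hodgeGroup = lefschetzGroup`, complex points `hodgeGroupC = lefschetzGroupC`)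
  for EVERY polarisation of: `T × E_τ` outside case (a)
  (**`IsRiemannForm.hodgeGroup_prod_ellipticPeriod_eq_lefschetzGroup_of_finrank_eq_three_of_forall_apply_ne`**),
  `T × E_τ` with `T` non-simple, `T × E_τ` with `E_τ` non-CM, and `(Y × E_{τ'}) × E_τ` for every abelian surface `Y`.
-/

noncomputable section

open Module Matrix NumberField

namespace Literature.Geometry.Kaehler

namespace ComplexTorus

/-! ## §1 `Hom(E_τ, Y × E_{τ'})` for a simple abelian surface `Y` -/

section Hom

variable {ι₁ ι₂ ι₃ : Type*} [Fintype ι₁] [Fintype ι₂] [Fintype ι₃] [DecidableEq ι₁] [DecidableEq ι₂] [DecidableEq ι₃]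
  {E₁ E₂ E₃ : Type*} [NormedAddCommGroup E₁] [NormedSpace ℂ E₁] [NormedAddCommGroup E₂] [NormedSpace ℂ E₂]
  [NormedAddCommGroup E₃] [NormedSpace ℂ E₃] (Φ₁ : (ι₁ → ℝ) ≃L[ℝ] E₁) (Φ₂ : (ι₂ → ℝ) ≃L[ℝ] E₂)
  (Θ : (ι₃ → ℝ) ≃L[ℝ] E₃)

/-- **`Hom_ℚ(Z, X₁ × X₂) = 0 ⟺ Hom_ℚ(Z, X₁) = 0` and `Hom_ℚ(Z, X₂) = 0`** (`Hom(Z, X₁ × X₂) = Hom(Z, X₁) ⊕ Hom(Z, X₂)`,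
the tree's `finrank_homRat_prod_right`). [cite: Lange2023AbelianVarietiesComplex, §2.4.4 Cor. 2.4.26 (proof, p. 124) and §1.1.2] -/
theorem homRat_prod_right_eq_bot_iff :
    homRat Θ (prodPeriod Φ₁ Φ₂) = ⊥ ↔ homRat Θ Φ₁ = ⊥ ∧ homRat Θ Φ₂ = ⊥ := by
  rw [← Submodule.finrank_eq_zero, ← Submodule.finrank_eq_zero, ← Submodule.finrank_eq_zero,
    finrank_homRat_prod_right Φ₁ Φ₂ Θ]
  omega

end Hom

section Surface

variable {κ : Type} [Fintype κ] [DecidableEq κ] {E : Type} [NormedAddCommGroup E] [NormedSpace ℂ E]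
  [FiniteDimensional ℂ E] {Ψ : (κ → ℝ) ≃L[ℝ] E} {η : E [⋀^Fin 2]→L[ℝ] ℝ} {τ' τ : ℂ} (hτ' : τ'.im ≠ 0) (hτ : τ.im ≠ 0)

omit [DecidableEq κ] in
/-- A complex abelian surface has `4 ≠ 2` real coordinates. [folklore] -/
private theorem card_ne_card_fin_two₈ (Ψ : (κ → ℝ) ≃L[ℝ] E) (h2 : finrank ℂ E = 2) :
    Fintype.card (Fin 2) ≠ Fintype.card κ := by
  rw [card_eq_two_mul_finrank Ψ, h2, Fintype.card_fin]
  norm_num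

/-- **`Hom_ℚ(E_τ, Y × E_{τ'}) = 0 ⟺ E_τ ≁ E_{τ'}` FOR A SIMPLE ABELIAN SURFACE `Y`** — `Hom(E_τ, Y) = 0` (simple of
different dimensions) and `Hom(E_τ, E_{τ'}) = 0` iff the two (simple) curves are not isogenous.
[cite: Lange2023AbelianVarietiesComplex, §2.4.4 Cor. 2.4.26 and §1.1.2 Cor. 1.1.16] [cite: MoonenZarhin1999LowDim, §3 Lemma (3.4)] -/
theorem IsSimple.homRat_ellipticPeriod_prod_ellipticPeriod_eq_bot_iff (hY : IsSimple Ψ) (h2 : finrank ℂ E = 2) :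
    homRat (ellipticPeriod hτ) (prodPeriod Ψ (ellipticPeriod hτ')) = ⊥ ↔
      ¬ IsIsogenous (ellipticPeriod hτ) (ellipticPeriod hτ') := by
  rw [homRat_prod_right_eq_bot_iff, (isSimple_ellipticPeriod hτ).homRat_eq_bot_of_card_ne hY (card_ne_card_fin_two₈ Ψ h2)]
  simp only [true_and]
  exact ⟨not_isIsogenous_of_homRat_eq_bot, (isSimple_ellipticPeriod hτ).homRat_eq_bot (isSimple_ellipticPeriod hτ')⟩

/-! ## §2 Prop. (3.8) for `X = Y × E_{τ'}`: `Hg(X × E_τ) = Hg(X) × Hg(E_τ) ⟺ E_{τ'} ≁ E_τ` -/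

/-- **MOONEN–ZARHIN (3.8) FOR `X = Y × E_{τ'}`, `Y` A SIMPLE POLARISED ABELIAN SURFACE, BOTH DIRECTIONS:
`Hg((Y × E_{τ'}) × E_τ)(ℂ) = Hg(Y × E_{τ'})(ℂ) × Hg(E_τ)(ℂ)` IF AND ONLY IF `E_{τ'}` AND `E_τ` ARE NOT ISOGENOUS** (all
`τ', τ`).  «⟸»: `E_τ` with complex multiplication — g51-#6 (the centre of `End⁰(Y × E_{τ'})` receives `k = ℚ(τ)` only
through `End⁰(E_{τ'})`); `E_τ` without — Lemma (3.4) with `Hom(E_τ, Y × E_{τ'}) = Hom(E_τ, E_{τ'}) = 0`.  «⟹»: a split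
Hodge group forces `Hom(E_τ, Y × E_{τ'}) = 0` («`Hg(X₁ × X₂) ≠ Hg(X₁) × Hg(X₂)` … if `Hom(X₁, X₂) ≠ 0`»).
[cite: MoonenZarhin1999LowDim, §3 (3.1) (p0006 L53–L60), Lemma (3.4), Prop. (3.8) (p0007 L55–L74) and §5 (5.4)–(5.5) (p0009 L82–L97)]
[cite: Lange2023AbelianVarietiesComplex, §2.4.4 Cor. 2.4.26] -/
theorem IsSimple.hodgeGroupC_prod_ellipticPeriod_prod_ellipticPeriod_eq_blockDiagProd_iff (hY : IsSimple Ψ)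
    (hη : IsRiemannForm Ψ η) (h2 : finrank ℂ E = 2) :
    hodgeGroupC (prodPeriod (prodPeriod Ψ (ellipticPeriod hτ')) (ellipticPeriod hτ)) =
        blockDiagProd (hodgeGroupC (prodPeriod Ψ (ellipticPeriod hτ'))) (hodgeGroupC (ellipticPeriod hτ)) ↔
      ¬ IsIsogenous (ellipticPeriod hτ') (ellipticPeriod hτ) := by
  constructor
  · intro h hi
    have hbot := homRat_swap_eq_bot_of_hodgeGroup_prodPeriod_eq_map_blockDiag _ _ (hodgeGroup_prod_eq_of_hodgeGroupC_prod_eq h)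
    exact (hY.homRat_ellipticPeriod_prod_ellipticPeriod_eq_bot_iff hτ' hτ h2).1 hbot (IsIsogenous.symm _ _ hi)
  · intro hni
    by_cases hE : ellipticEnd hτ = ⊥
    · exact IsAbelianVariety.hodgeGroupC_prod_ellipticPeriod_eq_blockDiagProd_of_homRat_eq_bot hτ
        (IsAbelianVariety.prod ⟨η, hη⟩ (isAbelianVariety_ellipticPeriod hτ')) hE
        ((hY.homRat_ellipticPeriod_prod_ellipticPeriod_eq_bot_iff hτ' hτ h2).2 fun h ↦ hni (IsIsogenous.symm _ _ h))
    · exact hY.hodgeGroupC_prod_ellipticPeriod_prod_ellipticPeriod_eq_blockDiagProd_of_not_isIsogenous hτ' hτ hη h2 hE hni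

/-- The same on REAL points: `Hg((Y × E_{τ'}) × E_τ)(ℝ) = Hg(Y × E_{τ'})(ℝ) × Hg(E_τ)(ℝ) ⟺ E_{τ'} ≁ E_τ` (`Y` a simple
polarised abelian surface). [cite: MoonenZarhin1999LowDim, §3 (3.1), Lemma (3.4) and Prop. (3.8) (p0007 L55–L74)] -/
theorem IsSimple.hodgeGroup_prod_ellipticPeriod_prod_ellipticPeriod_eq_iff (hY : IsSimple Ψ) (hη : IsRiemannForm Ψ η)
    (h2 : finrank ℂ E = 2) :
    hodgeGroup (prodPeriod (prodPeriod Ψ (ellipticPeriod hτ')) (ellipticPeriod hτ)) =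
        ((hodgeGroup (prodPeriod Ψ (ellipticPeriod hτ'))).prod (hodgeGroup (ellipticPeriod hτ))).map
          (blockDiag (κ ⊕ Fin 2) (Fin 2)) ↔
      ¬ IsIsogenous (ellipticPeriod hτ') (ellipticPeriod hτ) := by
  constructor
  · intro h hi
    have hbot := homRat_swap_eq_bot_of_hodgeGroup_prodPeriod_eq_map_blockDiag _ _ h
    exact (hY.homRat_ellipticPeriod_prod_ellipticPeriod_eq_bot_iff hτ' hτ h2).1 hbot (IsIsogenous.symm _ _ hi)
  · intro hni
    exact hodgeGroup_prod_eq_of_hodgeGroupC_prod_eq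
      ((hY.hodgeGroupC_prod_ellipticPeriod_prod_ellipticPeriod_eq_blockDiagProd_iff hτ' hτ hη h2).2 hni)

/-- In particular **`Hg((Y × E_{τ'}) × E_τ) ≠ Hg(Y × E_{τ'}) × Hg(E_τ)` when `E_{τ'} ∼ E_τ`** (complex points), for
every simple polarised abelian surface `Y` — the case `r = 2` of (5.4), where one passes to `Y × E_τ²` instead.
[cite: MoonenZarhin1999LowDim, §3 (3.1) (p0006 L53–L60) and §5 (5.4) (p0009 L86–L88)] -/
theorem IsSimple.hodgeGroupC_prod_ellipticPeriod_prod_ellipticPeriod_ne_blockDiagProd_of_isIsogenous (hY : IsSimple Ψ)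
    (hη : IsRiemannForm Ψ η) (h2 : finrank ℂ E = 2) (hi : IsIsogenous (ellipticPeriod hτ') (ellipticPeriod hτ)) :
    hodgeGroupC (prodPeriod (prodPeriod Ψ (ellipticPeriod hτ')) (ellipticPeriod hτ)) ≠
      blockDiagProd (hodgeGroupC (prodPeriod Ψ (ellipticPeriod hτ'))) (hodgeGroupC (ellipticPeriod hτ)) :=
  fun h ↦ (hY.hodgeGroupC_prod_ellipticPeriod_prod_ellipticPeriod_eq_blockDiagProd_iff hτ' hτ hη h2).1 h hi

end Surface

/-! ## §3 «`Hg(X) = Sp_D(V,φ)`» for the fourfolds `T × E_τ` outside case (a) and `(Y × E_{τ'}) × E_τ` -/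

section Lefschetz

variable {κ : Type} [Fintype κ] [DecidableEq κ] {E : Type} [NormedAddCommGroup E] [NormedSpace ℂ E]
  [FiniteDimensional ℂ E] {Ψ : (κ → ℝ) ≃L[ℝ] E} {η : E [⋀^Fin 2]→L[ℝ] ℝ} {τ : ℂ} (hτ : τ.im ≠ 0)
  {θ : (E × ℂ) [⋀^Fin 2]→L[ℝ] ℝ} {G : Matrix (κ ⊕ Fin 2) (κ ⊕ Fin 2) ℚ}

/-- **«`Hg(X) = Sp_D(V,φ)`» FOR `X = T × E_τ` WITH `T` A NON-SIMPLE POLARISED THREEFOLD, EVERY `E_τ` AND EVERY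
POLARISATION `θ` OF `X`: `Hg(X)(ℝ) = S(X)(ℝ)`** (the centraliser of `End⁰(X)` in `Sp(V, θ)`; from (D), g51-#6, by
«stably nondegenerate ⟹ `Hg = Lf`»). [cite: MoonenZarhin1999LowDim, Thm. (0.1) (4) (p0001 L131–L135) and §5 (5.4)–(5.5)]
[cite: Gordon1997, Thm. 7.5] [cite: Milne1999LefschetzClasses, §4 Thm. 4.4 and Cor. 4.5] [cite: Murty1984, Main Theorem] -/
theorem IsRiemannForm.hodgeGroup_prod_ellipticPeriod_eq_lefschetzGroup_of_not_isSimple_of_finrank_eq_three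
    (hθ : IsRiemannForm (prodPeriod Ψ (ellipticPeriod hτ)) θ) (hη : IsRiemannForm Ψ η) (h3 : finrank ℂ E = 3)
    (hX : ¬ IsSimple Ψ) :
    hodgeGroup (prodPeriod Ψ (ellipticPeriod hτ)) = lefschetzGroup (prodPeriod Ψ (ellipticPeriod hτ)) θ :=
  hθ.hodgeGroup_eq_lefschetzGroup_of_forall_divisorClasses_eq_hodgeClasses
    (hη.forall_divisorClasses_powPeriod_prod_ellipticPeriod_eq_hodgeClasses_of_not_isSimple_of_finrank_eq_three hτ h3 hX)

/-- Complex points: **`Hg(T × E_τ)(ℂ) = S(T × E_τ)(ℂ)`** for `T` a non-simple polarised threefold, every `E_τ`, every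
polarisation `θ` with rational Gram matrix `G`. [cite: MoonenZarhin1999LowDim, Thm. (0.1) (4) and §5 (5.4)–(5.5)] [cite: Milne1999LefschetzClasses, §4 Thm. 4.4] -/
theorem IsRiemannForm.hodgeGroupC_prod_ellipticPeriod_eq_lefschetzGroupC_of_not_isSimple_of_finrank_eq_three
    (hθ : IsRiemannForm (prodPeriod Ψ (ellipticPeriod hτ)) θ)
    (hG : G.map (Rat.cast : ℚ → ℝ) = latticeGram (prodPeriod Ψ (ellipticPeriod hτ)) θ) (hη : IsRiemannForm Ψ η)
    (h3 : finrank ℂ E = 3) (hX : ¬ IsSimple Ψ) :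
    hodgeGroupC (prodPeriod Ψ (ellipticPeriod hτ)) = lefschetzGroupC (prodPeriod Ψ (ellipticPeriod hτ)) G :=
  hθ.hodgeGroupC_eq_lefschetzGroupC_of_forall_divisorClasses_eq_hodgeClasses hG
    (hη.forall_divisorClasses_powPeriod_prod_ellipticPeriod_eq_hodgeClasses_of_not_isSimple_of_finrank_eq_three hτ h3 hX)

/-- **«`Hg(X) = Sp_D(V,φ)`» FOR `X = T × E_τ` WITH `E_τ` WITHOUT COMPLEX MULTIPLICATION**, every polarised threefold `T`,
every polarisation of `X` (real points). [cite: MoonenZarhin1999LowDim, Thm. (0.1) (4) and §5 (5.4) (p0009 L82–L91)] [cite: Gordon1997, Thm. 7.5] -/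
theorem IsRiemannForm.hodgeGroup_prod_ellipticPeriod_eq_lefschetzGroup_of_finrank_eq_three_of_ellipticEnd_eq_bot
    (hθ : IsRiemannForm (prodPeriod Ψ (ellipticPeriod hτ)) θ) (hη : IsRiemannForm Ψ η) (h3 : finrank ℂ E = 3)
    (hE : ellipticEnd hτ = ⊥) :
    hodgeGroup (prodPeriod Ψ (ellipticPeriod hτ)) = lefschetzGroup (prodPeriod Ψ (ellipticPeriod hτ)) θ :=
  hθ.hodgeGroup_eq_lefschetzGroup_of_forall_divisorClasses_eq_hodgeClasses
    (hη.forall_divisorClasses_powPeriod_prod_ellipticPeriod_eq_hodgeClasses_of_finrank_eq_three_of_ellipticEnd_eq_bot hτ h3 hE)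

end Lefschetz

section LefschetzCaseA

variable {κ : Type} [Fintype κ] [DecidableEq κ] [Nonempty κ] {E : Type} [NormedAddCommGroup E] [NormedSpace ℂ E]
  [FiniteDimensional ℂ E] {Ψ : (κ → ℝ) ≃L[ℝ] E} {η : E [⋀^Fin 2]→L[ℝ] ℝ} {τ : ℂ} (hτ : τ.im ≠ 0)
  {θ : (E × ℂ) [⋀^Fin 2]→L[ℝ] ℝ} {G : Matrix (κ ⊕ Fin 2) (κ ⊕ Fin 2) ℚ}

/-- **MOONEN–ZARHIN THM. (0.1) (4), THE HODGE-GROUP HALF, FOR `X = T × E_τ` OUTSIDE CASE (a): `Hg(X)(ℝ) = Sp_D(V,φ)(ℝ) =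
S(X)(ℝ)`** for every polarised complex abelian threefold `T`, every elliptic curve `E_τ` and every polarisation of `X`,
provided that when `T` is simple and `E_τ` has complex multiplication by `k = ℚ(τ)` no ring embedding of the centre of
`End⁰(T)` takes the value `τ`. [cite: MoonenZarhin1999LowDim, Thm. (0.1) (4) (p0001 L131–L135), case (a) (p0001 L77–L80) and §5 (5.4)–(5.5) (p0009 L82–L97)]
[cite: Gordon1997, Thm. 7.5] [cite: Milne1999LefschetzClasses, §4 Thm. 4.4 and Cor. 4.5] [cite: Murty1984, Main Theorem] -/
theorem IsRiemannForm.hodgeGroup_prod_ellipticPeriod_eq_lefschetzGroup_of_finrank_eq_three_of_forall_apply_ne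
    (hθ : IsRiemannForm (prodPeriod Ψ (ellipticPeriod hτ)) θ) (hη : IsRiemannForm Ψ η) (h3 : finrank ℂ E = 3)
    (ha : ∀ hX : IsSimple Ψ, ellipticEnd hτ ≠ ⊥ → ∀ φ : centerField Ψ hX →+* ℂ, ∀ c, φ c ≠ τ) :
    hodgeGroup (prodPeriod Ψ (ellipticPeriod hτ)) = lefschetzGroup (prodPeriod Ψ (ellipticPeriod hτ)) θ :=
  hθ.hodgeGroup_eq_lefschetzGroup_of_forall_divisorClasses_eq_hodgeClasses
    (hη.forall_divisorClasses_powPeriod_prod_ellipticPeriod_eq_hodgeClasses_of_finrank_eq_three_of_forall_apply_ne hτ h3 ha)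

/-- Complex points: **`Hg(T × E_τ)(ℂ) = S(T × E_τ)(ℂ)` outside case (a)**, every polarisation with rational Gram matrix `G`.
[cite: MoonenZarhin1999LowDim, Thm. (0.1) (4) (p0001 L131–L135) and §5 (5.4)–(5.5)] [cite: Milne1999LefschetzClasses, §4 Thm. 4.4] -/
theorem IsRiemannForm.hodgeGroupC_prod_ellipticPeriod_eq_lefschetzGroupC_of_finrank_eq_three_of_forall_apply_ne
    (hθ : IsRiemannForm (prodPeriod Ψ (ellipticPeriod hτ)) θ)
    (hG : G.map (Rat.cast : ℚ → ℝ) = latticeGram (prodPeriod Ψ (ellipticPeriod hτ)) θ) (hη : IsRiemannForm Ψ η)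
    (h3 : finrank ℂ E = 3) (ha : ∀ hX : IsSimple Ψ, ellipticEnd hτ ≠ ⊥ → ∀ φ : centerField Ψ hX →+* ℂ, ∀ c, φ c ≠ τ) :
    hodgeGroupC (prodPeriod Ψ (ellipticPeriod hτ)) = lefschetzGroupC (prodPeriod Ψ (ellipticPeriod hτ)) G :=
  hθ.hodgeGroupC_eq_lefschetzGroupC_of_forall_divisorClasses_eq_hodgeClasses hG
    (hη.forall_divisorClasses_powPeriod_prod_ellipticPeriod_eq_hodgeClasses_of_finrank_eq_three_of_forall_apply_ne hτ h3 ha)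

/-- **Totally real centre (when `T` is simple): `Hg(T × E_τ)(ℝ) = S(T × E_τ)(ℝ)` for every `E_τ` and every polarisation.**
[cite: MoonenZarhin1999LowDim, Thm. (0.1) (4), §3 Prop. (3.8) proof (p0007 L65–L74) and §5 (5.4)–(5.5)] [cite: Gordon1997, Thm. 7.5] -/
theorem IsRiemannForm.hodgeGroup_prod_ellipticPeriod_eq_lefschetzGroup_of_finrank_eq_three_of_isTotallyReal
    (hθ : IsRiemannForm (prodPeriod Ψ (ellipticPeriod hτ)) θ) (hη : IsRiemannForm Ψ η) (h3 : finrank ℂ E = 3)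
    (hreal : ∀ hX : IsSimple Ψ, IsTotallyReal (centerField Ψ hX)) :
    hodgeGroup (prodPeriod Ψ (ellipticPeriod hτ)) = lefschetzGroup (prodPeriod Ψ (ellipticPeriod hτ)) θ :=
  hθ.hodgeGroup_eq_lefschetzGroup_of_forall_divisorClasses_eq_hodgeClasses
    (hη.forall_divisorClasses_powPeriod_prod_ellipticPeriod_eq_hodgeClasses_of_finrank_eq_three_of_isTotallyReal hτ h3 hreal)

end LefschetzCaseA

section LefschetzSurface

variable {κ : Type} [Fintype κ] [DecidableEq κ] {E : Type} [NormedAddCommGroup E] [NormedSpace ℂ E]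
  [FiniteDimensional ℂ E] {Ψ : (κ → ℝ) ≃L[ℝ] E} {η : E [⋀^Fin 2]→L[ℝ] ℝ} {τ' τ : ℂ} (hτ' : τ'.im ≠ 0) (hτ : τ.im ≠ 0)
  {θ : ((E × ℂ) × ℂ) [⋀^Fin 2]→L[ℝ] ℝ} {G : Matrix ((κ ⊕ Fin 2) ⊕ Fin 2) ((κ ⊕ Fin 2) ⊕ Fin 2) ℚ}

/-- **«`Hg(X) = Sp_D(V,φ)`» FOR `X = (Y × E_{τ'}) × E_τ`, EVERY POLARISED ABELIAN SURFACE `Y`, ALL `τ', τ`, EVERY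
POLARISATION of `X` (real points).** [cite: MoonenZarhin1999LowDim, Thm. (0.1) (4) and §5 (5.4)–(5.5) (p0009 L82–L97)] [cite: Gordon1997, Thm. 7.5]
[cite: Milne1999LefschetzClasses, §4 Thm. 4.4 and Cor. 4.5] -/
theorem IsRiemannForm.hodgeGroup_prod_ellipticPeriod_prod_ellipticPeriod_eq_lefschetzGroup_of_finrank_eq_two
    (hθ : IsRiemannForm (prodPeriod (prodPeriod Ψ (ellipticPeriod hτ')) (ellipticPeriod hτ)) θ) (hη : IsRiemannForm Ψ η)
    (h2 : finrank ℂ E = 2) :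
    hodgeGroup (prodPeriod (prodPeriod Ψ (ellipticPeriod hτ')) (ellipticPeriod hτ)) =
      lefschetzGroup (prodPeriod (prodPeriod Ψ (ellipticPeriod hτ')) (ellipticPeriod hτ)) θ :=
  hθ.hodgeGroup_eq_lefschetzGroup_of_forall_divisorClasses_eq_hodgeClasses
    (hη.forall_divisorClasses_powPeriod_prod_ellipticPeriod_prod_ellipticPeriod_eq_hodgeClasses_of_finrank_eq_two hτ' hτ h2)

/-- Complex points: `Hg((Y × E_{τ'}) × E_τ)(ℂ) = S((Y × E_{τ'}) × E_τ)(ℂ)` for every polarised abelian surface `Y`, all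
`τ', τ`, every polarisation with rational Gram matrix `G`. [cite: MoonenZarhin1999LowDim, Thm. (0.1) (4) and §5 (5.4)–(5.5)] [cite: Milne1999LefschetzClasses, §4 Thm. 4.4] -/
theorem IsRiemannForm.hodgeGroupC_prod_ellipticPeriod_prod_ellipticPeriod_eq_lefschetzGroupC_of_finrank_eq_two
    (hθ : IsRiemannForm (prodPeriod (prodPeriod Ψ (ellipticPeriod hτ')) (ellipticPeriod hτ)) θ)
    (hG : G.map (Rat.cast : ℚ → ℝ) = latticeGram (prodPeriod (prodPeriod Ψ (ellipticPeriod hτ')) (ellipticPeriod hτ)) θ)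
    (hη : IsRiemannForm Ψ η) (h2 : finrank ℂ E = 2) :
    hodgeGroupC (prodPeriod (prodPeriod Ψ (ellipticPeriod hτ')) (ellipticPeriod hτ)) =
      lefschetzGroupC (prodPeriod (prodPeriod Ψ (ellipticPeriod hτ')) (ellipticPeriod hτ)) G :=
  hθ.hodgeGroupC_eq_lefschetzGroupC_of_forall_divisorClasses_eq_hodgeClasses hG
    (hη.forall_divisorClasses_powPeriod_prod_ellipticPeriod_prod_ellipticPeriod_eq_hodgeClasses_of_finrank_eq_two hτ' hτ h2)

end LefschetzSurface

end ComplexTorus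

end Literature.Geometry.Kaehler
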